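import Mathlib

/-!
# Plane curves over a field: weak Bezout and affine coordinate changes

Folklore facts about `P ∈ k[X₀, X₁]` over a field `k`, via `k[X₀, X₁] ≅ k[X][Y]`
(`toPP`: `X₀ ↦ Y` the outer variable, `X₁ ↦ X` the inner one; `aeval_toPP`, `eval_toPP`):

* `dvd_of_infinite_commonZeros` — WEAK BEZOUT: `G` irreducible and `V(G) ∩ V(H) ⊆ k²` infinite
  imply `G ∣ H` (elimination in `k(X)[Y]` through Gauss's lemma: a nonzero `r(X) ∈ (G, H)`
  confines the common zeros to finitely many lines `X = y`, each meeting `V(G)` finitely unless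
  `G` vanishes on it, which primitivity forbids).
* `affEquiv` — algebra automorphisms of `k[X₀, X₁]` from pointwise-inverse substitutions
  (`k` infinite); `linear_dvd_of_vanish` — a polynomial vanishing on a line is divisible by it.

## References

* [Fulton1969] W. Fulton, *Algebraic Curves*, Benjamin 1969, Ch. 1 §6 (plane curves without common
  component meet in finitely many points; elimination via Gauss's lemma).
* [Lang2002] S. Lang, *Algebra*, 3rd ed., Springer GTM 211, Ch. IV §2 (Gauss's lemma).
-/

noncomputable section

open scoped Polynomial
open Polynomial

namespace Literature.RingTheory.MvPolynomial.PlaneCurves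

variable {k : Type*} [Field k]

/-- Bivariate polynomials `k[X₀, X₁]` as `k[X][Y]`: `X₀ ↦ Y` (outer variable), `X₁ ↦ X` (inner).
[folklore] -/
noncomputable def toPP (k : Type*) [Field k] : MvPolynomial (Fin 2) k ≃ₐ[k] k[X][X] :=
  (MvPolynomial.finSuccEquiv k 1).trans (Polynomial.mapAlgEquiv (MvPolynomial.uniqueAlgEquiv k (Fin 1)))

/-- `toPP` sends `X₁` to the inner variable. [folklore] -/
theorem toPP_X_one : toPP k (MvPolynomial.X 1) = C Polynomial.X := by
  have h3 : (MvPolynomial.finSuccEquiv k 1) (MvPolynomial.X (0 : Fin 1).succ) =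
      C (MvPolynomial.X 0) := MvPolynomial.finSuccEquiv_X_succ
  rw [show (MvPolynomial.X 1 : MvPolynomial (Fin 2) k) = MvPolynomial.X (0 : Fin 1).succ from rfl]
  simp only [toPP, AlgEquiv.trans_apply, h3, Polynomial.coe_mapAlgEquiv, Polynomial.map_C]
  congr 1
  simp [MvPolynomial.uniqueAlgEquiv]

/-- Evaluation through `toPP` in a `k`-algebra: inner variable at `y`, outer at `z`. [folklore] -/
theorem aeval_toPP {A : Type*} [CommRing A] [Algebra k A] (G : MvPolynomial (Fin 2) k) (z y : A) :
    ((toPP k G).map (Polynomial.aeval y : k[X] →ₐ[k] A).toRingHom).eval z =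
      MvPolynomial.aeval ![z, y] G := by
  let f : MvPolynomial (Fin 2) k →+* A :=
    (evalRingHom z).comp ((mapRingHom (Polynomial.aeval y : k[X] →ₐ[k] A).toRingHom).comp
      (toPP k).toRingEquiv.toRingHom)
  have hfg : f = (MvPolynomial.aeval ![z, y] : MvPolynomial (Fin 2) k →ₐ[k] A).toRingHom := by
    refine MvPolynomial.ringHom_ext (fun r => ?_) (fun i => ?_)
    · have hC : toPP k (MvPolynomial.C r) = C (C r) := by
        simp [toPP, MvPolynomial.finSuccEquiv_apply, Polynomial.coe_mapAlgEquiv]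
      simp only [f, RingHom.coe_comp, Function.comp_apply]
      rw [show (toPP k).toRingEquiv.toRingHom (MvPolynomial.C r) = toPP k (MvPolynomial.C r) from rfl,
        hC]
      simp
    · fin_cases i
      · have h0 : toPP k (MvPolynomial.X 0) = Polynomial.X := by
          simp [toPP, MvPolynomial.finSuccEquiv_X_zero, Polynomial.coe_mapAlgEquiv]
        simp [f, h0]
      · have h1 : (MvPolynomial.X ⟨1, by norm_num⟩ : MvPolynomial (Fin 2) k) = MvPolynomial.X 1 := rfl
        simp only [f, RingHom.coe_comp, Function.comp_apply, h1]
        rw [show (toPP k).toRingEquiv.toRingHom (MvPolynomial.X 1) = toPP k (MvPolynomial.X 1) from rfl,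
          toPP_X_one]
        simp
  exact RingHom.congr_fun hfg G


/-- Evaluation through `toPP`: inner variable at `y`, outer at `z`. [folklore] -/
theorem eval_toPP (G : MvPolynomial (Fin 2) k) (z y : k) :
    ((toPP k G).map (evalRingHom y)).eval z = MvPolynomial.eval ![z, y] G := by
  have h := aeval_toPP (A := k) G z y
  have e1 : (MvPolynomial.aeval ![z, y]) G = MvPolynomial.eval ![z, y] G := rfl
  have e2 : (Polynomial.aeval y : k[X] →ₐ[k] k).toRingHom = evalRingHom y := by
    ext p <;> simp
  rw [e1, e2] at h
  exact h

/-- `C (X - C y)` divides `h ∈ k[X][Y]` iff `h` vanishes identically on the line `{inner = y}`.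
[folklore] -/
theorem C_X_sub_C_dvd_iff (h : k[X][X]) (y : k) :
    C (Polynomial.X - C y) ∣ h ↔ h.map (evalRingHom y) = 0 := by
  rw [Polynomial.C_dvd_iff_dvd_coeff]
  constructor
  · intro hd
    ext n
    rw [Polynomial.coeff_map, coeff_zero]
    have := hd n
    rw [Polynomial.dvd_iff_isRoot] at this
    exact this
  · intro h0 n
    rw [Polynomial.dvd_iff_isRoot, IsRoot]
    have := congrArg (fun q => q.coeff n) h0
    simpa using this

/-- If the line `{inner = y}` meets `V(g) ∩ V(h)` in infinitely many points, both `g` and `h`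
vanish on it. [folklore] -/
theorem dvd_of_fiber_infinite {g h : k[X][X]} {y : k}
    (hinf : {z : k | (g.map (evalRingHom y)).eval z = 0 ∧ (h.map (evalRingHom y)).eval z = 0}.Infinite) :
    C (Polynomial.X - C y) ∣ g ∧ C (Polynomial.X - C y) ∣ h := by
  rw [C_X_sub_C_dvd_iff, C_X_sub_C_dvd_iff]
  by_contra hne
  rw [not_and_or] at hne
  apply hinf
  rcases hne with hne | hne
  · exact (Polynomial.finite_setOf_isRoot hne).subset fun z hz => hz.1
  · exact (Polynomial.finite_setOf_isRoot hne).subset fun z hz => hz.2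

/-- An irreducible polynomial of positive degree over a domain is primitive. [folklore] -/
theorem isPrimitive_of_irreducible' {R : Type*} [CommRing R] [IsDomain R] {g : R[X]}
    (hg : Irreducible g) (hdeg : g.natDegree ≠ 0) : g.IsPrimitive := by
  rw [Polynomial.isPrimitive_iff_isUnit_of_C_dvd]
  intro r hr
  obtain ⟨q, hq⟩ := hr
  rcases hg.isUnit_or_isUnit hq with hu | hu
  · exact Polynomial.isUnit_C.mp hu
  · exfalso
    apply hdeg
    have := Polynomial.natDegree_mul_le (p := C r) (q := q)
    rw [← hq, Polynomial.natDegree_C, Polynomial.natDegree_eq_zero_of_isUnit hu] at this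
    omega

/-- Elimination: if `g` is primitive of positive degree and does not divide `h` in `R[Y]`
(`R = k[X]`), some nonzero `r ∈ R` lies in the ideal `(g, h)`. [folklore] -/
theorem exists_C_mem_span_of_not_dvd {g h : k[X][X]} (hg : Irreducible g) (hdeg : g.natDegree ≠ 0)
    (hndvd : ¬ g ∣ h) : ∃ r : k[X], r ≠ 0 ∧ ∃ U V : k[X][X], U * g + V * h = C r := by
  set K := FractionRing k[X]
  have hprim : g.IsPrimitive := isPrimitive_of_irreducible' hg hdeg
  have hgK : Irreducible (g.map (algebraMap k[X] K)) :=
    (hprim.irreducible_iff_irreducible_map_fraction_map (K := K)).mp hg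
  have hndvdK : ¬ g.map (algebraMap k[X] K) ∣ h.map (algebraMap k[X] K) := fun hd =>
    hndvd ((hprim.dvd_iff_fraction_map_dvd_fraction_map K).mpr hd)
  have hcop : IsCoprime (g.map (algebraMap k[X] K)) (h.map (algebraMap k[X] K)) :=
    (hgK.coprime_iff_not_dvd).mpr hndvdK
  obtain ⟨u, v, huv⟩ := hcop
  obtain ⟨bu, hbu, hU⟩ := IsLocalization.integerNormalization_spec (nonZeroDivisors k[X]) u
  obtain ⟨bv, hbv, hV⟩ := IsLocalization.integerNormalization_spec (nonZeroDivisors k[X]) v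
  set U := IsLocalization.integerNormalization (nonZeroDivisors k[X]) u
  set V := IsLocalization.integerNormalization (nonZeroDivisors k[X]) v
  refine ⟨bu * bv, mul_ne_zero (nonZeroDivisors.ne_zero hbu) (nonZeroDivisors.ne_zero hbv),
    U * C bv, V * C bu, ?_⟩
  apply Polynomial.map_injective (algebraMap k[X] K) (IsFractionRing.injective k[X] K)
  simp only [Polynomial.map_add, Polynomial.map_mul, Polynomial.map_C, hU, hV]
  rw [Algebra.smul_def, Algebra.smul_def, Polynomial.algebraMap_apply, Polynomial.algebraMap_apply]
  have := congrArg (fun w => C (algebraMap k[X] K bu) * C (algebraMap k[X] K bv) * w) huv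
  simp only [mul_one] at this
  rw [map_mul, C_mul, ← this]
  ring


/-- `C r` irreducible in `R[Y]` forces `r` irreducible in `R`. [folklore] -/
theorem irreducible_of_irreducible_C {R : Type*} [CommRing R] [IsDomain R] {r : R}
    (h : Irreducible (C r : R[X])) : Irreducible r := by
  refine ⟨fun hu => h.not_isUnit (Polynomial.isUnit_C.mpr hu), fun a b hab => ?_⟩
  have := h.isUnit_or_isUnit (show C r = C a * C b by rw [hab, C_mul])
  rcases this with hu | hu
  · exact Or.inl (Polynomial.isUnit_C.mp hu)
  · exact Or.inr (Polynomial.isUnit_C.mp hu)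

/-- BEZOUT (weak form). An irreducible plane curve sharing infinitely many points with another
curve is a component of it: `G` irreducible, `V(G) ∩ V(H)` infinite `⟹ G ∣ H`. (Elimination in
`k(X)[Y]` via Gauss's lemma: a nonzero `r(X) ∈ (G, H)` confines common zeros to finitely many
lines `X = y`, each meeting `V(G)` finitely unless `G` vanishes on it.) [folklore] -/
theorem dvd_of_infinite_commonZeros {G H : MvPolynomial (Fin 2) k} (hG : Irreducible G)
    (hinf : {p : Fin 2 → k | MvPolynomial.eval p G = 0 ∧ MvPolynomial.eval p H = 0}.Infinite) :
    G ∣ H := by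
  set g := toPP k G with hgdef
  set h := toPP k H with hhdef
  have hg : Irreducible g := (MulEquiv.irreducible_iff (toPP k).toMulEquiv).mpr hG
  -- it suffices to prove `g ∣ h`
  suffices hdvd : g ∣ h by
    obtain ⟨q, hq⟩ := hdvd
    refine ⟨(toPP k).symm q, ?_⟩
    apply (toPP k).injective
    rw [map_mul, AlgEquiv.apply_symm_apply]
    exact hq
  -- the common zero set in the `(outer, inner) = (p 0, p 1)` description
  set Z := {p : Fin 2 → k | MvPolynomial.eval p G = 0 ∧ MvPolynomial.eval p H = 0} with hZ
  set T : k → Set k := fun y =>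
    {z : k | (g.map (evalRingHom y)).eval z = 0 ∧ (h.map (evalRingHom y)).eval z = 0} with hT
  have hfiber : ∀ y : k, {p ∈ Z | p 1 = y} ⊆ (fun z : k => (![z, y] : Fin 2 → k)) '' T y := by
    rintro y p ⟨⟨hpG, hpH⟩, hp1⟩
    subst hp1
    refine ⟨p 0, ?_, ?_⟩
    · have ep : (![p 0, p 1] : Fin 2 → k) = p := by ext i; fin_cases i <;> rfl
      refine ⟨?_, ?_⟩
      · show ((toPP k G).map (evalRingHom (p 1))).eval (p 0) = 0
        rw [eval_toPP, ep]; exact hpG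
      · show ((toPP k H).map (evalRingHom (p 1))).eval (p 0) = 0
        rw [eval_toPP, ep]; exact hpH
    · ext i; fin_cases i <;> rfl
  -- if the inner coordinates of `Z` are confined to a finite set, some fiber is infinite
  have key : ∀ S : Set k, S.Finite → Z ⊆ {p | p 1 ∈ S} →
      ∃ y ∈ S, C (Polynomial.X - C y) ∣ g ∧ C (Polynomial.X - C y) ∣ h := by
    intro S hS hZS
    by_contra hno
    push Not at hno
    apply hinf
    have hfin : ∀ y ∈ S, {p ∈ Z | p 1 = y}.Finite := by
      intro y hy
      refine ((Set.Finite.image _ ?_).subset (hfiber y))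
      by_contra hTinf
      exact (fun h2 => hno y hy h2.1 h2.2) (dvd_of_fiber_infinite hTinf)
    refine (hS.biUnion hfin).subset ?_
    intro p hp
    exact Set.mem_biUnion (hZS hp) ⟨hp, rfl⟩
  by_cases hdeg : g.natDegree = 0
  · -- CASE `g = C r₀`: `G` is a polynomial in the inner variable only
    set r₀ := g.coeff 0 with hr₀
    have hgC : g = C r₀ := Polynomial.eq_C_of_natDegree_eq_zero hdeg
    have hr₀irr : Irreducible r₀ := irreducible_of_irreducible_C (hgC ▸ hg)
    have hr₀0 : r₀ ≠ 0 := hr₀irr.ne_zero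
    obtain ⟨y, -, hyg, hyh⟩ := key {y | r₀.IsRoot y} (Polynomial.finite_setOf_isRoot hr₀0) (by
      rintro p ⟨hpG, -⟩
      show r₀.IsRoot (p 1)
      have ep : (![p 0, p 1] : Fin 2 → k) = p := by ext i; fin_cases i <;> rfl
      have := eval_toPP G (p 0) (p 1)
      rw [ep, hpG, ← hgdef, hgC, Polynomial.map_C, eval_C] at this
      exact this)
    -- `(X - y) ∣ r₀`, so `r₀ ~ X - y` and `g = C r₀ ∣ h`
    have hXy : (Polynomial.X - C y) ∣ r₀ := by
      rw [hgC, Polynomial.C_dvd_iff_dvd_coeff] at hyg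
      simpa using hyg 0
    have hass : Associated (Polynomial.X - C y) r₀ :=
      (Polynomial.irreducible_X_sub_C y).associated_of_dvd hr₀irr hXy
    rw [hgC]
    exact ((hass.map (Polynomial.C : k[X] →+* k[X][X])).dvd_iff_dvd_left).mp hyh
  · -- CASE `deg_Y g > 0`: `g` primitive; if `g ∤ h`, eliminate
    by_contra hndvd
    obtain ⟨r, hr0, U, V, hUV⟩ := exists_C_mem_span_of_not_dvd hg hdeg hndvd
    have hprim : g.IsPrimitive := isPrimitive_of_irreducible' hg hdeg
    obtain ⟨y, -, hyg, -⟩ := key {y | r.IsRoot y} (Polynomial.finite_setOf_isRoot hr0) (by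
      rintro p ⟨hpG, hpH⟩
      show r.IsRoot (p 1)
      have ep : (![p 0, p 1] : Fin 2 → k) = p := by ext i; fin_cases i <;> rfl
      have hG' := eval_toPP G (p 0) (p 1)
      have hH' := eval_toPP H (p 0) (p 1)
      rw [ep, hpG, ← hgdef] at hG'
      rw [ep, hpH, ← hhdef] at hH'
      have := congrArg (fun w : k[X][X] => (w.map (evalRingHom (p 1))).eval (p 0)) hUV
      simp only [Polynomial.map_add, Polynomial.map_mul, eval_add, eval_mul, Polynomial.map_C,
        eval_C, coe_evalRingHom] at this
      rw [hG', hH', mul_zero, mul_zero, add_zero] at this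
      exact this.symm)
    rw [Polynomial.isPrimitive_iff_isUnit_of_C_dvd] at hprim
    have hu := hprim _ hyg
    exact (Polynomial.not_isUnit_X_sub_C y) hu


/-! ### Affine changes of coordinates of the plane -/

section Affine

variable [Infinite k]

omit [Infinite k] in
/-- Evaluating an algebraic substitution. [folklore] -/
theorem eval_aeval_eq (φ : Fin 2 → MvPolynomial (Fin 2) k) (P : MvPolynomial (Fin 2) k)
    (p : Fin 2 → k) :
    MvPolynomial.eval p (MvPolynomial.aeval φ P) =
      MvPolynomial.eval (fun i => MvPolynomial.eval p (φ i)) P := by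
  have h : (MvPolynomial.eval p).comp (MvPolynomial.aeval φ).toRingHom =
      MvPolynomial.eval (fun i => MvPolynomial.eval p (φ i)) :=
    MvPolynomial.ringHom_ext (fun r => by simp) (fun i => by simp)
  exact RingHom.congr_fun h P

/-- Two substitutions that are pointwise inverse to each other give an algebra automorphism of
`k[X₀, X₁]` (`k` infinite, so polynomials are functions). [folklore] -/
noncomputable def affEquiv (φ ψ : Fin 2 → MvPolynomial (Fin 2) k)
    (h₁ : ∀ (p : Fin 2 → k) i, MvPolynomial.eval (fun j => MvPolynomial.eval p (ψ j)) (φ i) = p i)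
    (h₂ : ∀ (p : Fin 2 → k) i, MvPolynomial.eval (fun j => MvPolynomial.eval p (φ j)) (ψ i) = p i) :
    MvPolynomial (Fin 2) k ≃ₐ[k] MvPolynomial (Fin 2) k :=
  AlgEquiv.ofAlgHom (MvPolynomial.aeval φ) (MvPolynomial.aeval ψ)
    (by
      refine MvPolynomial.algHom_ext fun i => ?_
      rw [AlgHom.comp_apply, MvPolynomial.aeval_X, AlgHom.id_apply]
      apply MvPolynomial.funext
      intro p
      rw [eval_aeval_eq, MvPolynomial.eval_X]
      exact h₂ p i)
    (by
      refine MvPolynomial.algHom_ext fun i => ?_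
      rw [AlgHom.comp_apply, MvPolynomial.aeval_X, AlgHom.id_apply]
      apply MvPolynomial.funext
      intro p
      rw [eval_aeval_eq, MvPolynomial.eval_X]
      exact h₁ p i)

/-- `affEquiv` acts as the substitution `aeval φ`. [folklore] -/
theorem affEquiv_apply (φ ψ : Fin 2 → MvPolynomial (Fin 2) k) (h₁ h₂) (P : MvPolynomial (Fin 2) k) :
    affEquiv φ ψ h₁ h₂ P = MvPolynomial.aeval φ P := rfl

/-- The inverse of `affEquiv` acts as the substitution `aeval ψ`. [folklore] -/
theorem affEquiv_symm_apply (φ ψ : Fin 2 → MvPolynomial (Fin 2) k) (h₁ h₂)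
    (P : MvPolynomial (Fin 2) k) : (affEquiv φ ψ h₁ h₂).symm P = MvPolynomial.aeval ψ P := rfl

/-- `X₁ ∣ Q` iff `Q` vanishes on the axis `{z₁ = 0}`. [folklore] -/
theorem X_one_dvd_iff (Q : MvPolynomial (Fin 2) k) :
    MvPolynomial.X 1 ∣ Q ↔ ∀ z : k, MvPolynomial.eval ![z, 0] Q = 0 := by
  constructor
  · rintro ⟨R, rfl⟩ z
    simp
  · intro h
    have hX : toPP k (MvPolynomial.X 1) = C Polynomial.X := toPP_X_one
    have hdvd : C (Polynomial.X - C (0 : k)) ∣ toPP k Q := by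
      rw [C_X_sub_C_dvd_iff]
      apply Polynomial.funext
      intro z
      rw [eval_toPP, eval_zero]
      exact h z
    rw [map_zero, sub_zero, ← hX] at hdvd
    obtain ⟨R, hR⟩ := hdvd
    refine ⟨(toPP k).symm R, ?_⟩
    apply (toPP k).injective
    rw [map_mul, AlgEquiv.apply_symm_apply]
    exact hR

/-- LINE DIVISIBILITY. If `P` vanishes on the line `{w₁ z₀ − w₀ z₁ = κ}` (`w ≠ 0`), the linear
form `w₁ X₀ − w₀ X₁ − κ` divides `P`. [folklore] -/
theorem linear_dvd_of_vanish {P : MvPolynomial (Fin 2) k} {w : Fin 2 → k} (hw : w ≠ 0) (κ : k)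
    (hvan : ∀ p : Fin 2 → k, w 1 * p 0 - w 0 * p 1 = κ → MvPolynomial.eval p P = 0) :
    (MvPolynomial.C (w 1) * MvPolynomial.X 0 - MvPolynomial.C (w 0) * MvPolynomial.X 1 -
      MvPolynomial.C κ) ∣ P := by
  -- a complementary coordinate `α z₀ + β z₁` with `Δ := -(α w₀ + β w₁) ≠ 0`
  obtain ⟨α, β, hΔ⟩ : ∃ α β : k, -(α * w 0 + β * w 1) ≠ 0 := by
    by_cases h0 : w 0 = 0
    · refine ⟨0, 1, ?_⟩
      have h1 : w 1 ≠ 0 := by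
        intro h1; apply hw; funext i; fin_cases i <;> simp [h0, h1]
      simpa [h0] using h1
    · exact ⟨1, 0, by simpa using h0⟩
  set Δ : k := -(α * w 0 + β * w 1) with hΔdef
  set φ : Fin 2 → MvPolynomial (Fin 2) k :=
    ![MvPolynomial.C α * MvPolynomial.X 0 + MvPolynomial.C β * MvPolynomial.X 1,
      MvPolynomial.C (w 1) * MvPolynomial.X 0 - MvPolynomial.C (w 0) * MvPolynomial.X 1 -
        MvPolynomial.C κ] with hφ
  set ψ : Fin 2 → MvPolynomial (Fin 2) k :=
    ![MvPolynomial.C (-(w 0) / Δ) * MvPolynomial.X 0 +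
        MvPolynomial.C (-β / Δ) * (MvPolynomial.X 1 + MvPolynomial.C κ),
      MvPolynomial.C (-(w 1) / Δ) * MvPolynomial.X 0 +
        MvPolynomial.C (α / Δ) * (MvPolynomial.X 1 + MvPolynomial.C κ)] with hψ
  have h₁ : ∀ (p : Fin 2 → k) i,
      MvPolynomial.eval (fun j => MvPolynomial.eval p (ψ j)) (φ i) = p i := by
    intro p i
    fin_cases i
    · simp [hφ, hψ]
      field_simp
      ring
    · simp [hφ, hψ]
      field_simp
      ring
  have h₂ : ∀ (p : Fin 2 → k) i,
      MvPolynomial.eval (fun j => MvPolynomial.eval p (φ j)) (ψ i) = p i := by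
    intro p i
    fin_cases i
    · simp [hφ, hψ]
      field_simp
      ring
    · simp [hφ, hψ]
      field_simp
      ring
  set Φ := affEquiv φ ψ h₁ h₂ with hΦ
  -- `Q := Φ⁻¹ P` vanishes on the axis `{u₁ = 0}`
  set Q := Φ.symm P with hQ
  have hPQ : P = Φ Q := by rw [hQ, AlgEquiv.apply_symm_apply]
  have hQvan : ∀ z : k, MvPolynomial.eval ![z, 0] Q = 0 := by
    intro z
    -- the point of the line with complementary coordinate `z`
    set p : Fin 2 → k := fun j => MvPolynomial.eval ![z, 0] (ψ j) with hp
    have hline : w 1 * p 0 - w 0 * p 1 = κ := by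
      have := h₁ ![z, 0] 1
      simp [hφ] at this
      linear_combination this
    have h0 := hvan p hline
    rw [hPQ, hΦ, affEquiv_apply, eval_aeval_eq] at h0
    have e : (fun i => MvPolynomial.eval p (φ i)) = ![z, 0] := by
      funext i
      rw [hp]
      have := h₁ ![z, 0] i
      fin_cases i
      · simpa using this
      · simpa using this
    rw [e] at h0
    exact h0
  obtain ⟨R, hR⟩ := (X_one_dvd_iff Q).mpr hQvan
  refine ⟨Φ R, ?_⟩
  rw [hPQ, hR, map_mul]
  congr 1
  rw [hΦ, affEquiv_apply, MvPolynomial.aeval_X, hφ]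
  simp

end Affine

end Literature.RingTheory.MvPolynomial.PlaneCurves

end
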